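import Literature.NumberTheory.Automorphic.Liu2021.Def411WeilCarriersDoublingSeesawLine
import Literature.NumberTheory.Automorphic.Liu2021.Def411WeilCarriersAtLine
import HarnessLib

/-!
# [Liu2021, Def. 4.11]'s carriers `ω(μ, ε, χ)` at a line `⟨a⟩` do not depend on the enumeration `e : Fin N × Fin 1 ≃ Fin n`

Topic `NumberTheory/Automorphic/Liu2021`; namespace `Literature.NumberTheory.Automorphic.Liu2021.Def411WeilCarriersDoubling` (PROOF
sequel of ★ `GelbartRogawski1991/DoubledSeesawUndoubling` and ★ `Def411WeilCarriersAtLine`).  THEOREMS ONLY: no definition, no named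
fact, no instance, no `sorry`.  Nothing of [Liu2021] is asserted.

WHY.  The carrier `omegaAtLine L⁺ L c̄ N e (diag dV) … (isCompatible_chiSplittingLine … e …) a χ_W` of [Liu2021, Def. 4.11] is built from the
χ-attached compatible splitting `s_χ[e]` ([HarrisKudlaSweet1996, §1]'s `ι̃_{V,χ}`, [Liu2021, App. D Step 2]'s `ι_μ`; tree `chiSplittingLine`,
by DOUBLING [Kudla1994, §2]) of the dual pair `U(diag dV) × U(⟨a⟩)` into `Mp_ψ(𝕎_𝔸)ᶜᵒⁿᵗ`, the symplectic space `𝕎 = Res(V ⊗ W)` being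
ENUMERATED by a bijection `e : Fin N × Fin 1 ≃ Fin n` (Gram matrix `reindex e e (diag dV ⊗ T_W)`).  Consumers meet the same carrier at two
enumerations — the floor-0 programme P4 of the Hodge CM cell proves the line-class transport (stub S4a of crux H413) at the frame
`Equiv.prodUnique (Fin N) (Fin 1)` and states it for every `e`.  This file proves that NOTHING depends on `e`:
* §1 `omega_chiSplitting_reindex` — `ω(s_χ[e] X) ∘ R_{e′⁻¹e} = R_{e′⁻¹e} ∘ ω(s_χ[e′] X)` on `𝒮(𝔸^n)` for every `X ∈ U(diag dV ⊗ diag dW)(𝔸)`: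
  the case `N₂ = 0` (empty second summand) of the undoubled see-saw identity ★ `omega_chiSplitting_sumTensor_idxSplit` (χ-rigidity of the
  doubled Weil representation, [Kudla1994, Thm. 3.1]; [GelbartRogawski1991, §3.1 Prop. 3.1.1]), whose sum tensor against the Θ-witness of
  `𝒮(𝔸^0)` is the re-enumeration operator `R_{e′⁻¹e}` (`sumTensor_idxSplit_zero`);
* §2 `pairSmall₁_chiSplittingLine_reindex` — read back to the Kronecker index `Fin N × Fin 1` (★ `pairSmall₁`), the χ-attached pair splittings
  at `e` and at `e′` are EQUAL (joint injectivity of `(π, ω)` on `Mp_ψ(𝕎_𝔸)ᶜᵒⁿᵗ`, ★ `proj_pairSmall₁`, ★ `omega_pairSmall₁_apply`); hence the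
  finite Weil representations `finPairRep` of `U(diag dV)(𝔸_f) × U(⟨a⟩)(𝔸_f)` on `𝒮((𝔸_{L⁺,f})^{N×1})` are equal (`finPairRep_chiSplittingLine_reindex`);
* §3 **`exists_omegaAtLine_equiv_rhoVAtLine_reindex`** — the carriers at `e` and `e′` are isomorphic by `[f] ↦ [f]`, intertwining `rhoVAtLine`
  ON THE NOSE (functoriality of the maximal `χ`-quotient, ★ `TwistedCoinv.mapEquiv`), for every line `a` and every `χ_W ∈ Chi`.

## References

* [Liu2021] Y. Liu, *Fourier–Jacobi cycles and arithmetic relative trace formula*, Camb. J. Math. 9 (2021) = arXiv:2102.11518: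
  Def. 4.11 (l. 2092–2096), App. D §D.1 Step 1 footnote (l. 5215), Steps 2–3 (l. 5217–5221).
* [GelbartRogawski1991] S. Gelbart, J. Rogawski, Invent. Math. 105 (1991), §3.1 p. 454, Prop. 3.1.1 p. 455 L1–3, Remark p. 457 L4–13.
* [Kudla1994] S. Kudla, Israel J. Math. 87 (1994), §2 (doubled space, Siegel parabolic), §3 Thm. 3.1.
* [MoeglinVignerasWaldspurger1987] C. Mœglin, M.-F. Vignéras, J.-L. Waldspurger, LNM 1291 (1987), Chap. 2 II.1 (naturality of `Mp_ψ(W)`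
  in the model).
-/

set_option autoImplicit false

noncomputable section

open scoped Classical
open scoped Matrix Kronecker
open NumberField NumberField.mixedEmbedding IsDedekindDomain
open Literature.RepresentationTheory Literature.RepresentationTheory.HeisenbergGroup
open Literature.NumberTheory.Automorphic Literature.NumberTheory.Automorphic.UnitaryGroup
open Literature.NumberTheory.Weil1964
open Literature.RepresentationTheory.HarrisKudlaSweet1996
open Literature.NumberTheory.GaloisRepresentations
open Literature.NumberTheory.GelbartRogawski1991 Literature.NumberTheory.GelbartRogawski1991.UnitaryDualPair
open Literature.NumberTheory.GelbartRogawski1991.UnitaryDualPair.WeilCoinv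
open Literature.NumberTheory.GelbartRogawski1991.GRConstruction

namespace Literature.NumberTheory.Automorphic.Liu2021.Def411WeilCarriersDoubling

open Literature.NumberTheory.Automorphic.Liu2021.Def411WeilCarriers

/-! ## §1 The χ-attached splitting is covariant in the enumeration `e` at the `ω`-level -/

section Frame

variable (L : Type) [Field L] [NumberField L] [IsCMField L]
variable {N M n n' : ℕ} (e : Fin N × Fin M ≃ Fin n) (e' : Fin N × Fin M ≃ Fin n')
  (dV : Fin N → L) (hdV : ∀ i, IsCMField.complexConj L (dV i) = dV i) (hdV0 : ∀ i, dV i ≠ 0)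
  (dW : Fin M → L) (hdW : ∀ i, IsCMField.complexConj L (dW i) = dW i) (hdW0 : ∀ i, dW i ≠ 0)
  (χ : HeckeCharacter L) (hχu : χ.IsUnitary) (hχs : IsSplittingChar L 1 χ)

omit [NumberField L] [IsCMField L] in
/-- with an EMPTY second summand (`N₂ = 0`) the see-saw re-enumeration `Fin (N + 0) × Fin M ≃ (Fin N × Fin M) ⊕ (Fin 0 × Fin M)` reads every
matrix `X` as `diag(X, 1)`. [cite: Kudla1984, §1] -/
theorem reindex_sumProdDistrib_zero {R : Type*} [Zero R] [One R] (X : Matrix (Fin N × Fin M) (Fin N × Fin M) R) :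
    Matrix.reindex
        ((finSumFinEquiv.prodCongr (Equiv.refl (Fin M))).symm.trans (Equiv.sumProdDistrib (Fin N) (Fin 0) (Fin M)))
        ((finSumFinEquiv.prodCongr (Equiv.refl (Fin M))).symm.trans (Equiv.sumProdDistrib (Fin N) (Fin 0) (Fin M)))
        (X : Matrix (Fin (N + 0) × Fin M) (Fin (N + 0) × Fin M) R) =
      Matrix.fromBlocks X 0 0 1 := by
  ext (i | i) (j | j)
  · obtain ⟨i, m⟩ := i
    obtain ⟨j, m'⟩ := j
    simp only [Matrix.reindex_apply, Matrix.submatrix_apply, Equiv.symm_trans_apply, Equiv.sumProdDistrib_symm_apply_left,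
      Equiv.symm_symm, Equiv.prodCongr_apply, Prod.map_apply, Equiv.coe_refl, id_eq, finSumFinEquiv_apply_left,
      Matrix.fromBlocks_apply₁₁]
    rfl
  · exact j.1.elim0
  · exact i.1.elim0
  · exact i.1.elim0

omit [IsCMField L] in
/-- the sum tensor along `idxSplit e e′ e_∅` (empty second summand) against the Θ-witness of `𝒮(𝔸^0)` IS the re-enumeration operator
`R_{e′⁻¹ e}` of `𝒮(𝔸^n′) → 𝒮(𝔸^n)`. [cite: Kudla1984, §1] [cite: MoeglinVignerasWaldspurger1987, Chap. 2 II.1] -/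
theorem sumTensor_idxSplit_zero (Φ : piSchwartzBruhat (Fp L) (Fin n')) :
    sumTensor (Fp L) (idxSplit (N₁ := N) (N₂ := 0) e e' (Equiv.equivOfIsEmpty (Fin 0 × Fin M) (Fin 0))) Φ (testVec L (n := 0)) =
      piSBReindex (Fp L) (e'.symm.trans e) Φ := by
  apply Subtype.ext
  funext w
  rw [coe_sumTensor_apply, coe_piSBReindex_apply]
  have h0 : (fun k : Fin 0 => w ((idxSplit (N₁ := N) (N₂ := 0) e e' (Equiv.equivOfIsEmpty (Fin 0 × Fin M) (Fin 0))).symm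
      (Sum.inr k))) = 0 := Subsingleton.elim _ _
  rw [h0, testVec_zero, mul_one]
  -- the first-summand coordinates `ι⁻¹(inl i) = e (castAdd 0 (e′⁻¹ i).1, (e′⁻¹ i).2)` and `e (e′⁻¹ i)` agree definitionally
  congr 1

/-- **`ω(s_χ[e] X) ∘ R_{e′⁻¹e} = R_{e′⁻¹e} ∘ ω(s_χ[e′] X)`** — the χ-attached compatible splittings of `U(diag dV ⊗ diag dW)(𝔸)` at two
enumerations `e`, `e′` of `V ⊗ W` have Weil operators conjugate by the re-enumeration `R_{e′⁻¹e} : 𝒮(𝔸^{n′}) ≃ 𝒮(𝔸^n)`: the case of an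
EMPTY second summand of the undoubled see-saw identity `omega_chiSplitting_sumTensor_idxSplit` (χ-rigidity of the doubled Weil
representation under the doubled block embedding `H(V) × H(0) → H(V)`).
[cite: Kudla1994, §2 (doubled space, Siegel parabolic), Thm. 3.1] [cite: GelbartRogawski1991, §3.1 Prop. 3.1.1 p. 455 L1–3]
[cite: MoeglinVignerasWaldspurger1987, Chap. 2 II.1] -/
theorem omega_chiSplitting_reindex
    (X : ↥(UnitaryGroup.adelicPair (Fp L) L (IsCMField.complexConj L) N M (Matrix.diagonal dV) (Matrix.diagonal dW)))
    (Φ : piSchwartzBruhat (Fp L) (Fin n')) :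
    adelicMpCont.omega (Fp L) (Fin n) (gramA L e dV hdV dW hdW) (chiSplitting L e dV hdV hdV0 dW hdW hdW0 χ hχu hχs X)
        (piSBReindex (Fp L) (e'.symm.trans e) Φ) =
      piSBReindex (Fp L) (e'.symm.trans e)
        (adelicMpCont.omega (Fp L) (Fin n') (gramA L e' dV hdV dW hdW) (chiSplitting L e' dV hdV hdV0 dW hdW hdW0 χ hχu hχs X) Φ) := by
  have h := omega_chiSplitting_sumTensor_idxSplit L (N₁ := N) (N₂ := 0) e e' (Equiv.equivOfIsEmpty (Fin 0 × Fin M) (Fin 0))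
    dV hdV hdV0 (fun i => i.elim0) (fun i => i.elim0) (fun i => i.elim0) dV hdV hdV0 (fun _ => rfl) (fun j => j.elim0)
    dW hdW hdW0 χ hχu hχs X X (reindex_sumProdDistrib_zero _) Φ (testVec L (n := 0))
  have h1 := sumTensor_idxSplit_zero L e e' Φ
  have h2 := sumTensor_idxSplit_zero L e e'
    (adelicMpCont.omega (Fp L) (Fin n') (gramA L e' dV hdV dW hdW) (chiSplitting L e' dV hdV hdV0 dW hdW hdW0 χ hχu hχs X) Φ)
  exact ((congrArg (adelicMpCont.omega (Fp L) (Fin n) (gramA L e dV hdV dW hdW)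
    (chiSplitting L e dV hdV hdV0 dW hdW hdW0 χ hχu hχs X)) h1).symm.trans h).trans h2

end Frame

/-! ## §2 At a hermitian line: the Kronecker read-backs of `s_χ[e]` and `s_χ[e′]` are EQUAL -/

section Tools

variable (F : Type) [Field F] [NumberField F] {ι ι' ι'' : Type} [Fintype ι] [Fintype ι'] [Fintype ι'']
  (e : ι ≃ ι') (e' : ι ≃ ι'')

/-- `R_{e′⁻¹e} (R_{e′} Φ) = R_e Φ` (re-enumeration operators compose). [cite: MoeglinVignerasWaldspurger1987, Chap. 2 II.1] -/
theorem piSBReindex_symm_trans_piSBReindex (Φ : piSchwartzBruhat F ι) :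
    piSBReindex F (e'.symm.trans e) (piSBReindex F e' Φ) = piSBReindex F e Φ := by
  apply Subtype.ext
  funext w
  simp only [coe_piSBReindex_apply]
  exact congrArg (Φ : (ι → AdeleRing (𝓞 F) F) → ℂ)
    (funext fun x => by simp only [Function.comp_apply, Equiv.trans_apply, Equiv.symm_apply_apply])

/-- `R_e⁻¹ (R_{e′⁻¹e} Ψ) = R_{e′}⁻¹ Ψ`. [cite: MoeglinVignerasWaldspurger1987, Chap. 2 II.1] -/
theorem piSBReindex_symm_piSBReindex_symm_trans (Ψ : piSchwartzBruhat F ι'') :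
    (piSBReindex F e).symm (piSBReindex F (e'.symm.trans e) Ψ) = (piSBReindex F e').symm Ψ := by
  apply Subtype.ext
  funext u
  simp only [coe_piSBReindex_symm_apply, coe_piSBReindex_apply]
  exact congrArg (Ψ : (ι'' → AdeleRing (𝓞 F) F) → ℂ)
    (funext fun x => by simp only [Function.comp_apply, Equiv.trans_apply, Equiv.symm_apply_apply])

variable [DecidableEq ι] {T : Matrix ι ι (AdeleRing (𝓞 F) F)}

set_option maxHeartbeats 1600000 in
-- (the nested subtypes `Mp_ψ(𝕎_𝔸)ᶜᵒⁿᵗ ≤ Mp_ψ(𝕎_𝔸) ≤ Sp × GL(𝒮)` are compared in `whnf`; budget of ★ `GRConstruction.eq_of_proj_eq_of_omega_eq`)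
/-- `(π, ω)` are jointly injective on `Mp_ψ(𝕎_𝔸)ᶜᵒⁿᵗ` (an element IS its pair (symplectic projection, operator)) — the tree's
`GRConstruction.eq_of_proj_eq_of_omega_eq` at an arbitrary index and Gram matrix.
[cite: Weil1964, Chap. III n° 37 p. 188] [cite: GelbartRogawski1991, §3.1 p. 454] -/
theorem adelicMpCont_eq_of_proj_eq_of_omega_eq (x y : adelicMpCont F ι T)
    (h1 : adelicMpCont.proj F ι T x = adelicMpCont.proj F ι T y)
    (h2 : adelicMpCont.omega F ι T x = adelicMpCont.omega F ι T y) : x = y := by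
  refine Subtype.ext (Subtype.ext (Prod.ext h1 (LinearEquiv.ext fun f => ?_)))
  have h3 := LinearMap.congr_fun h2 f
  rw [adelicMpCont.omega_apply, omegaPsi_apply, adelicMpCont.omega_apply, omegaPsi_apply] at h3
  exact h3

/-- `finRepMp` depends on the splitting only (congruence in the splitting, for the book-keeping of its archimedean-vector proof).
[cite: Weil1964, Chap. III n° 37–38 p. 188–190] -/
theorem finRepMp_congr {H : Type*} [Monoid H] (hT : IsUnit T) {s s' : H →* adelicMpCont F ι T} (h : s = s')
    (harch : ∀ (h : H) (a w : ι → mixedSpace F),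
      (adelicMpCont.proj F ι T (s h)).1 (archVec F ι a, archVec F ι w) = (archVec F ι a, archVec F ι w))
    (harch' : ∀ (h : H) (a w : ι → mixedSpace F),
      (adelicMpCont.proj F ι T (s' h)).1 (archVec F ι a, archVec F ι w) = (archVec F ι a, archVec F ι w)) :
    finRepMp hT s harch = finRepMp hT s' harch' := by
  subst h
  rfl

end Tools

section Line

variable (L : Type) [Field L] [NumberField L] [IsCMField L]
variable {N n n' : ℕ} (e : Fin N × Fin 1 ≃ Fin n) (e' : Fin N × Fin 1 ≃ Fin n')
  (dV : Fin N → L) (hdV : ∀ i, IsCMField.complexConj L (dV i) = dV i) (hdV0 : ∀ i, dV i ≠ 0)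
  (χ : HeckeCharacter L) (hχu : χ.IsUnitary) (hχs : IsSplittingChar L 1 χ)
  (TW : Matrix (Fin 1) (Fin 1) (Fp L)) (hWd : IsUnit TW.det) (JW : Matrix (Fin 1) (Fin 1) L)
  (hJW : JW = TW.map (algebraMap (Fp L) L))

/-- **the Weil operators of the χ-attached LINE splittings `s_χ[e]`, `s_χ[e′]` of `U(diag dV)(𝔸) × U(⟨T_W⟩)(𝔸)`, read back to the
Kronecker index `Fin N × Fin 1`, coincide**: `ω(pairSmall₁ e s_χ[e] p) = ω(pairSmall₁ e′ s_χ[e′] p)` on `𝒮(𝔸^{N×1})` — the two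
re-enumerations `R_e`, `R_{e′}` absorb the conjugator `R_{e′⁻¹e}` of §1.
[cite: GelbartRogawski1991, §3.1 p. 454, Prop. 3.1.1 p. 455 L1–3] [cite: Kudla1994, §2 (doubled space, Siegel parabolic), Thm. 3.1]
[cite: Liu2021, App. D §D.1 Step 2 (l. 5219)] -/
theorem omega_pairSmall₁_chiSplittingLine_reindex
    (p : ↥(UnitaryGroup.adelic (Fp L) L (IsCMField.complexConj L) N (Matrix.diagonal dV)) ×
      ↥(UnitaryGroup.adelic (Fp L) L (IsCMField.complexConj L) 1 JW))
    (Φ : piSchwartzBruhat (Fp L) (Fin N × Fin 1)) :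
    adelicMpCont.omega (Fp L) (Fin N × Fin 1)
        ((realDiagonal L dV hdV).map (algebraMap (Fp L) (AdeleRing (𝓞 (Fp L)) (Fp L))) ⊗ₖ
          TW.map (algebraMap (Fp L) (AdeleRing (𝓞 (Fp L)) (Fp L))))
        (pairSmall₁ (Fp L) L (IsCMField.complexConj L) N 1 e (Matrix.diagonal dV) JW
          (chiSplittingLine L e dV hdV hdV0 χ hχu hχs TW hWd JW hJW) p) Φ =
      adelicMpCont.omega (Fp L) (Fin N × Fin 1)
        ((realDiagonal L dV hdV).map (algebraMap (Fp L) (AdeleRing (𝓞 (Fp L)) (Fp L))) ⊗ₖ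
          TW.map (algebraMap (Fp L) (AdeleRing (𝓞 (Fp L)) (Fp L))))
        (pairSmall₁ (Fp L) L (IsCMField.complexConj L) N 1 e' (Matrix.diagonal dV) JW
          (chiSplittingLine L e' dV hdV hdV0 χ hχu hχs TW hWd JW hJW) p) Φ := by
  -- the common pair point `Y = (k ⊗ 1)(1 ⊗ u)` read over `diag (lineW T_W)`
  let Y := UnitaryGroup.adelicInl (Fp L) L (IsCMField.complexConj L) N 1 (Matrix.diagonal dV) JW p.1 *
    UnitaryGroup.adelicInr (Fp L) L (IsCMField.complexConj L) N 1 (Matrix.diagonal dV) JW p.2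
  let Yt : ↥(UnitaryGroup.adelicPair (Fp L) L (IsCMField.complexConj L) N 1 (Matrix.diagonal dV)
      (Matrix.diagonal (lineW L TW))) :=
    ⟨Y.1, mem_adelicPair_of_eq (Fp L) L (IsCMField.complexConj L) N 1 rfl (diagonal_lineW L TW hJW).symm Y.2⟩
  -- unfolding at `e`: `ω_K(pairSmall₁ e s_χ[e] p) Φ = R_e⁻¹ (ω(s_χ[e, lineW] Ỹ) (R_e Φ))`
  have hL : adelicMpCont.omega (Fp L) (Fin N × Fin 1)
        ((realDiagonal L dV hdV).map (algebraMap (Fp L) (AdeleRing (𝓞 (Fp L)) (Fp L))) ⊗ₖ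
          TW.map (algebraMap (Fp L) (AdeleRing (𝓞 (Fp L)) (Fp L))))
        (pairSmall₁ (Fp L) L (IsCMField.complexConj L) N 1 e (Matrix.diagonal dV) JW
          (chiSplittingLine L e dV hdV hdV0 χ hχu hχs TW hWd JW hJW) p) Φ =
      (piSBReindex (Fp L) e).symm (adelicMpCont.omega (Fp L) (Fin n)
        (gramA L e dV hdV (lineW L TW) (complexConj_lineW L TW))
        (chiSplitting L e dV hdV hdV0 (lineW L TW) (complexConj_lineW L TW) (lineW_ne_zero L TW hWd) χ hχu hχs Yt)
        (piSBReindex (Fp L) e Φ)) :=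
    (omega_pairSmall₁_apply (Fp L) L (IsCMField.complexConj L) N 1 e (Matrix.diagonal dV) JW
      (chiSplittingLine L e dV hdV hdV0 χ hχu hχs TW hWd JW hJW) p Φ).trans
      (congrArg (piSBReindex (Fp L) e).symm
        (omega_splittingCongr_apply (Fp L) L (IsCMField.complexConj L) N 1 e (Matrix.diagonal dV) (realDiagonal_lineW L TW)
          (diagonal_lineW L TW hJW)
          (chiSplitting L e dV hdV hdV0 (lineW L TW) (complexConj_lineW L TW) (lineW_ne_zero L TW hWd) χ hχu hχs) Y _))
  have hR : adelicMpCont.omega (Fp L) (Fin N × Fin 1)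
        ((realDiagonal L dV hdV).map (algebraMap (Fp L) (AdeleRing (𝓞 (Fp L)) (Fp L))) ⊗ₖ
          TW.map (algebraMap (Fp L) (AdeleRing (𝓞 (Fp L)) (Fp L))))
        (pairSmall₁ (Fp L) L (IsCMField.complexConj L) N 1 e' (Matrix.diagonal dV) JW
          (chiSplittingLine L e' dV hdV hdV0 χ hχu hχs TW hWd JW hJW) p) Φ =
      (piSBReindex (Fp L) e').symm (adelicMpCont.omega (Fp L) (Fin n')
        (gramA L e' dV hdV (lineW L TW) (complexConj_lineW L TW))
        (chiSplitting L e' dV hdV hdV0 (lineW L TW) (complexConj_lineW L TW) (lineW_ne_zero L TW hWd) χ hχu hχs Yt)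
        (piSBReindex (Fp L) e' Φ)) :=
    (omega_pairSmall₁_apply (Fp L) L (IsCMField.complexConj L) N 1 e' (Matrix.diagonal dV) JW
      (chiSplittingLine L e' dV hdV hdV0 χ hχu hχs TW hWd JW hJW) p Φ).trans
      (congrArg (piSBReindex (Fp L) e').symm
        (omega_splittingCongr_apply (Fp L) L (IsCMField.complexConj L) N 1 e' (Matrix.diagonal dV) (realDiagonal_lineW L TW)
          (diagonal_lineW L TW hJW)
          (chiSplitting L e' dV hdV hdV0 (lineW L TW) (complexConj_lineW L TW) (lineW_ne_zero L TW hWd) χ hχu hχs) Y _))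
  -- §1 at `Ψ := R_{e′} Φ`, and `R_e = R_{e′⁻¹e} R_{e′}`, `R_e⁻¹ R_{e′⁻¹e} = R_{e′}⁻¹`
  have hF := omega_chiSplitting_reindex L e e' dV hdV hdV0 (lineW L TW) (complexConj_lineW L TW) (lineW_ne_zero L TW hWd)
    χ hχu hχs Yt (piSBReindex (Fp L) e' Φ)
  have hF' := (congrArg (adelicMpCont.omega (Fp L) (Fin n) (gramA L e dV hdV (lineW L TW) (complexConj_lineW L TW))
    (chiSplitting L e dV hdV hdV0 (lineW L TW) (complexConj_lineW L TW) (lineW_ne_zero L TW hWd) χ hχu hχs Yt))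
    (piSBReindex_symm_trans_piSBReindex (Fp L) e e' Φ)).symm.trans hF
  exact hL.trans (((congrArg (piSBReindex (Fp L) e).symm hF').trans
    (piSBReindex_symm_piSBReindex_symm_trans (Fp L) e e' _)).trans hR.symm)

/-- **FRAME COVARIANCE OF THE χ-ATTACHED PAIR SPLITTING AT A LINE**: read back to the Kronecker index `Fin N × Fin 1`, the χ-attached
compatible splittings of `U(diag dV) × U(⟨T_W⟩)` built at two enumerations `e`, `e′` of `V ⊗ W` are EQUAL homomorphisms
`U(diag dV)(𝔸) × U(J_W)(𝔸) →* Mp_ψ(𝕎_{diag dV ⊗ T_W})ᶜᵒⁿᵗ` — same symplectic projection (★ `proj_pairSmall₁`) and same operator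
(`omega_pairSmall₁_chiSplittingLine_reindex`).
[cite: GelbartRogawski1991, §3.1 p. 454, Prop. 3.1.1 p. 455 L1–3] [cite: Kudla1994, §2 (doubled space, Siegel parabolic), Thm. 3.1]
[cite: Liu2021, App. D §D.1 Step 2 (l. 5219)] -/
theorem pairSmall₁_chiSplittingLine_reindex (hW : TW.IsSymm) :
    pairSmall₁ (Fp L) L (IsCMField.complexConj L) N 1 e (Matrix.diagonal dV) JW
        (chiSplittingLine L e dV hdV hdV0 χ hχu hχs TW hWd JW hJW) =
      pairSmall₁ (Fp L) L (IsCMField.complexConj L) N 1 e' (Matrix.diagonal dV) JW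
        (chiSplittingLine L e' dV hdV hdV0 χ hχu hχs TW hWd JW hJW) := by
  refine MonoidHom.ext fun p => adelicMpCont_eq_of_proj_eq_of_omega_eq (Fp L) _ _ ?_ (LinearMap.ext fun Φ =>
    omega_pairSmall₁_chiSplittingLine_reindex L e e' dV hdV hdV0 χ hχu hχs TW hWd JW hJW p Φ)
  exact (proj_pairSmall₁ (Fp L) L (IsCMField.complexConj L) N 1 e (Matrix.diagonal dV) JW (complexConj_imagUnit L)
      (imagUnit_ne_zero L) (imagUnit_mul_self L) (realDiagonal_isSymm L dV hdV) hW (isUnit_det_realDiagonal L dV hdV hdV0) hWd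
      (realDiagonal_map L dV hdV).symm hJW (isCompatible_chiSplittingLine L e dV hdV hdV0 χ hχu hχs TW hW hWd JW hJW) p).trans
    (proj_pairSmall₁ (Fp L) L (IsCMField.complexConj L) N 1 e' (Matrix.diagonal dV) JW (complexConj_imagUnit L)
      (imagUnit_ne_zero L) (imagUnit_mul_self L) (realDiagonal_isSymm L dV hdV) hW (isUnit_det_realDiagonal L dV hdV hdV0) hWd
      (realDiagonal_map L dV hdV).symm hJW (isCompatible_chiSplittingLine L e' dV hdV hdV0 χ hχu hχs TW hW hWd JW hJW) p).symm

/-- **hence the finite Weil representations of `U(diag dV)(𝔸_f) × U(J_W)(𝔸_f)` on `𝒮((𝔸_{L⁺,f})^{N×1})` at the χ-attached splittings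
built at `e` and at `e′` are EQUAL** (`finPairRep` reads the pair splitting through `pairSmall₁`).
[cite: Weil1964, Chap. III n° 37–38 p. 188–190] [cite: GelbartRogawski1991, §3.1 Prop. 3.1.1 p. 455] [cite: Liu2021, App. D §D.1 Steps 2–3 (l. 5217–5219)] -/
theorem finPairRep_chiSplittingLine_reindex (hW : TW.IsSymm) :
    finPairRep (Fp L) L (IsCMField.complexConj L) N 1 e (Matrix.diagonal dV) JW (complexConj_imagUnit L) (imagUnit_ne_zero L)
        (imagUnit_mul_self L) (realDiagonal_isSymm L dV hdV) hW (isUnit_det_realDiagonal L dV hdV hdV0) hWd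
        (realDiagonal_map L dV hdV).symm hJW (isCompatible_chiSplittingLine L e dV hdV hdV0 χ hχu hχs TW hW hWd JW hJW) =
      finPairRep (Fp L) L (IsCMField.complexConj L) N 1 e' (Matrix.diagonal dV) JW (complexConj_imagUnit L) (imagUnit_ne_zero L)
        (imagUnit_mul_self L) (realDiagonal_isSymm L dV hdV) hW (isUnit_det_realDiagonal L dV hdV hdV0) hWd
        (realDiagonal_map L dV hdV).symm hJW (isCompatible_chiSplittingLine L e' dV hdV hdV0 χ hχu hχs TW hW hWd JW hJW) :=
  finRepMp_congr (Fp L) _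
    (congrArg (MonoidHom.comp · (finPairToAdelic (Fp L) L (IsCMField.complexConj L) N 1 (Matrix.diagonal dV) JW))
      (pairSmall₁_chiSplittingLine_reindex L e e' dV hdV hdV0 χ hχu hχs TW hWd JW hJW hW)) _ _

end Line

/-! ## §3 The carriers `ω(μ, ε, χ)` at a line `⟨a⟩` do not depend on the enumeration -/

section Carriers

variable (L : Type) [Field L] [NumberField L] [IsCMField L]
variable {N n n' : ℕ} (e : Fin N × Fin 1 ≃ Fin n) (e' : Fin N × Fin 1 ≃ Fin n')
  (dV : Fin N → L) (hdV : ∀ i, IsCMField.complexConj L (dV i) = dV i) (hdV0 : ∀ i, dV i ≠ 0)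
  (χ : HeckeCharacter L) (hχu : χ.IsUnitary) (hχs : IsSplittingChar L 1 χ)
  (a : (Fp L)ˣ) (χW : Chi (Fp L) L (IsCMField.complexConj L))

/-- **ENUMERATION INDEPENDENCE OF `ω(μ,ε,χ)` AT A LINE.**  For every CM field `L`, real diagonal frame `dV`, unitary splitting character
`χ`, line `⟨a⟩`, `χ_W ∈ Chi`, and ANY two enumerations `e : Fin N × Fin 1 ≃ Fin n`, `e′ : Fin N × Fin 1 ≃ Fin n′` of `V ⊗ W`, Liu's
carriers at the χ-attached splitting families built at `e` and at `e′` are isomorphic by `[f] ↦ [f]` (`hmk`), `U(diag dV)(𝔸_f)`-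
equivariantly ON THE NOSE for `rhoVAtLine` — the two finite Weil representations of the pair being equal
(`finPairRep_chiSplittingLine_reindex`), the maximal `χ`-quotient is functorial (★ `TwistedCoinv.mapEquiv` at `Q := 1`, `η := 1`).
[cite: Liu2021, Def. 4.11 (l. 2092–2096); App. D §D.1 Step 1 footnote (l. 5215), Steps 2–3 (l. 5219–5221)]
[cite: GelbartRogawski1991, §3.1 Remark p. 457 L4–13] [cite: MoeglinVignerasWaldspurger1987, Chap. 2 II.1] -/
theorem exists_omegaAtLine_equiv_rhoVAtLine_reindex :
    ∃ Ψ : omegaAtLine (Fp L) L (IsCMField.complexConj L) N e (Matrix.diagonal dV) (complexConj_imagUnit L)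
          (imagUnit_ne_zero L) (imagUnit_mul_self L) (realDiagonal_isSymm L dV hdV) (isUnit_det_realDiagonal L dV hdV hdV0)
          (realDiagonal_map L dV hdV).symm
          (fun a' => isCompatible_chiSplittingLine L e dV hdV hdV0 χ hχu hχs (TW (Fp L) a') (isSymm_TW (Fp L) a')
            (isUnit_det_TW (Fp L) a') (JW (Fp L) L a') (JW_eq (Fp L) L a')) a χW ≃ₗ[ℂ]
        omegaAtLine (Fp L) L (IsCMField.complexConj L) N e' (Matrix.diagonal dV) (complexConj_imagUnit L)
          (imagUnit_ne_zero L) (imagUnit_mul_self L) (realDiagonal_isSymm L dV hdV) (isUnit_det_realDiagonal L dV hdV hdV0)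
          (realDiagonal_map L dV hdV).symm
          (fun a' => isCompatible_chiSplittingLine L e' dV hdV hdV0 χ hχu hχs (TW (Fp L) a') (isSymm_TW (Fp L) a')
            (isUnit_det_TW (Fp L) a') (JW (Fp L) L a') (JW_eq (Fp L) L a')) a χW,
      (∀ f : FinSB (Fp L) (Fin N × Fin 1),
        Ψ (TwistedCoinv.mk _ (lineChar (Fp L) L (IsCMField.complexConj L) a χW.1) f) =
          TwistedCoinv.mk _ (lineChar (Fp L) L (IsCMField.complexConj L) a χW.1) f) ∧
      ∀ (k : UnitaryGroup.finAdelic (Fp L) L (IsCMField.complexConj L) N (Matrix.diagonal dV))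
        (x : omegaAtLine (Fp L) L (IsCMField.complexConj L) N e (Matrix.diagonal dV) (complexConj_imagUnit L)
          (imagUnit_ne_zero L) (imagUnit_mul_self L) (realDiagonal_isSymm L dV hdV) (isUnit_det_realDiagonal L dV hdV hdV0)
          (realDiagonal_map L dV hdV).symm
          (fun a' => isCompatible_chiSplittingLine L e dV hdV hdV0 χ hχu hχs (TW (Fp L) a') (isSymm_TW (Fp L) a')
            (isUnit_det_TW (Fp L) a') (JW (Fp L) L a') (JW_eq (Fp L) L a')) a χW),
        Ψ (rhoVAtLine (Fp L) L (IsCMField.complexConj L) N e (Matrix.diagonal dV) (complexConj_imagUnit L)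
              (imagUnit_ne_zero L) (imagUnit_mul_self L) (realDiagonal_isSymm L dV hdV) (isUnit_det_realDiagonal L dV hdV hdV0)
              (realDiagonal_map L dV hdV).symm
              (fun a' => isCompatible_chiSplittingLine L e dV hdV hdV0 χ hχu hχs (TW (Fp L) a') (isSymm_TW (Fp L) a')
                (isUnit_det_TW (Fp L) a') (JW (Fp L) L a') (JW_eq (Fp L) L a')) a χW k x) =
          rhoVAtLine (Fp L) L (IsCMField.complexConj L) N e' (Matrix.diagonal dV) (complexConj_imagUnit L)
              (imagUnit_ne_zero L) (imagUnit_mul_self L) (realDiagonal_isSymm L dV hdV) (isUnit_det_realDiagonal L dV hdV hdV0)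
              (realDiagonal_map L dV hdV).symm
              (fun a' => isCompatible_chiSplittingLine L e' dV hdV hdV0 χ hχu hχs (TW (Fp L) a') (isSymm_TW (Fp L) a')
                (isUnit_det_TW (Fp L) a') (JW (Fp L) L a') (JW_eq (Fp L) L a')) a χW k (Ψ x) := by
  -- the two finite Weil representations of the pair at the line `⟨a⟩` are equal
  have hP := finPairRep_chiSplittingLine_reindex L e e' dV hdV hdV0 χ hχu hχs (TW (Fp L) a) (isUnit_det_TW (Fp L) a)
    (JW (Fp L) L a) (JW_eq (Fp L) L a) (isSymm_TW (Fp L) a)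
  have hW : ∀ (u : UnitaryGroup.finAdelic (Fp L) L (IsCMField.complexConj L) 1 (JW (Fp L) L a)) (f : FinSB (Fp L) (Fin N × Fin 1)),
      finPairRepW (Fp L) L (IsCMField.complexConj L) N 1 e' (Matrix.diagonal dV) (JW (Fp L) L a) (complexConj_imagUnit L)
          (imagUnit_ne_zero L) (imagUnit_mul_self L) (realDiagonal_isSymm L dV hdV) (isSymm_TW (Fp L) a)
          (isUnit_det_realDiagonal L dV hdV hdV0) (isUnit_det_TW (Fp L) a) (realDiagonal_map L dV hdV).symm (JW_eq (Fp L) L a)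
          (isCompatible_chiSplittingLine L e' dV hdV hdV0 χ hχu hχs (TW (Fp L) a) (isSymm_TW (Fp L) a) (isUnit_det_TW (Fp L) a)
            (JW (Fp L) L a) (JW_eq (Fp L) L a)) u ((LinearEquiv.refl ℂ (FinSB (Fp L) (Fin N × Fin 1))) f) =
        (((1 : UnitaryGroup.finAdelic (Fp L) L (IsCMField.complexConj L) 1 (JW (Fp L) L a) → ℂˣ) u : ℂˣ) : ℂ) •
          (LinearEquiv.refl ℂ (FinSB (Fp L) (Fin N × Fin 1)))
            (finPairRepW (Fp L) L (IsCMField.complexConj L) N 1 e (Matrix.diagonal dV) (JW (Fp L) L a) (complexConj_imagUnit L)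
              (imagUnit_ne_zero L) (imagUnit_mul_self L) (realDiagonal_isSymm L dV hdV) (isSymm_TW (Fp L) a)
              (isUnit_det_realDiagonal L dV hdV hdV0) (isUnit_det_TW (Fp L) a) (realDiagonal_map L dV hdV).symm (JW_eq (Fp L) L a)
              (isCompatible_chiSplittingLine L e dV hdV hdV0 χ hχu hχs (TW (Fp L) a) (isSymm_TW (Fp L) a) (isUnit_det_TW (Fp L) a)
                (JW (Fp L) L a) (JW_eq (Fp L) L a)) u f) := fun u f => by
    rw [Pi.one_apply, Units.val_one, one_smul, LinearEquiv.refl_apply, LinearEquiv.refl_apply, finPairRepW_apply,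
      finPairRepW_apply, hP]
  have hχ : ∀ u : UnitaryGroup.finAdelic (Fp L) L (IsCMField.complexConj L) 1 (JW (Fp L) L a),
      lineChar (Fp L) L (IsCMField.complexConj L) a χW.1 u =
        (1 : UnitaryGroup.finAdelic (Fp L) L (IsCMField.complexConj L) 1 (JW (Fp L) L a) → ℂˣ) u *
          lineChar (Fp L) L (IsCMField.complexConj L) a χW.1 u := fun u => by
    rw [Pi.one_apply, one_mul]
  have hV : ∀ (k : UnitaryGroup.finAdelic (Fp L) L (IsCMField.complexConj L) N (Matrix.diagonal dV))
      (f : FinSB (Fp L) (Fin N × Fin 1)),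
      finPairRepV (Fp L) L (IsCMField.complexConj L) N 1 e' (Matrix.diagonal dV) (JW (Fp L) L a) (complexConj_imagUnit L)
          (imagUnit_ne_zero L) (imagUnit_mul_self L) (realDiagonal_isSymm L dV hdV) (isSymm_TW (Fp L) a)
          (isUnit_det_realDiagonal L dV hdV hdV0) (isUnit_det_TW (Fp L) a) (realDiagonal_map L dV hdV).symm (JW_eq (Fp L) L a)
          (isCompatible_chiSplittingLine L e' dV hdV hdV0 χ hχu hχs (TW (Fp L) a) (isSymm_TW (Fp L) a) (isUnit_det_TW (Fp L) a)
            (JW (Fp L) L a) (JW_eq (Fp L) L a)) k ((LinearEquiv.refl ℂ (FinSB (Fp L) (Fin N × Fin 1))) f) =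
        (1 : ℂ) • (LinearEquiv.refl ℂ (FinSB (Fp L) (Fin N × Fin 1)))
          (finPairRepV (Fp L) L (IsCMField.complexConj L) N 1 e (Matrix.diagonal dV) (JW (Fp L) L a) (complexConj_imagUnit L)
            (imagUnit_ne_zero L) (imagUnit_mul_self L) (realDiagonal_isSymm L dV hdV) (isSymm_TW (Fp L) a)
            (isUnit_det_realDiagonal L dV hdV hdV0) (isUnit_det_TW (Fp L) a) (realDiagonal_map L dV hdV).symm (JW_eq (Fp L) L a)
            (isCompatible_chiSplittingLine L e dV hdV hdV0 χ hχu hχs (TW (Fp L) a) (isSymm_TW (Fp L) a) (isUnit_det_TW (Fp L) a)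
              (JW (Fp L) L a) (JW_eq (Fp L) L a)) k f) := fun k f => by
    rw [one_smul, LinearEquiv.refl_apply, LinearEquiv.refl_apply, finPairRepV_apply, finPairRepV_apply, hP]
  refine ⟨TwistedCoinv.mapEquiv _ (lineChar (Fp L) L (IsCMField.complexConj L) a χW.1) _
      (lineChar (Fp L) L (IsCMField.complexConj L) a χW.1) (LinearEquiv.refl ℂ (FinSB (Fp L) (Fin N × Fin 1))) 1 hW hχ,
    fun f => rfl, fun k x => ?_⟩
  have h := TwistedCoinv.mapEquiv_rep _ (lineChar (Fp L) L (IsCMField.complexConj L) a χW.1) _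
    (lineChar (Fp L) L (IsCMField.complexConj L) a χW.1) _ _
    (commute_finPairRepV_finPairRepW (Fp L) L (IsCMField.complexConj L) N 1 e (Matrix.diagonal dV) (JW (Fp L) L a)
      (complexConj_imagUnit L) (imagUnit_ne_zero L) (imagUnit_mul_self L) (realDiagonal_isSymm L dV hdV) (isSymm_TW (Fp L) a)
      (isUnit_det_realDiagonal L dV hdV hdV0) (isUnit_det_TW (Fp L) a) (realDiagonal_map L dV hdV).symm (JW_eq (Fp L) L a)
      (isCompatible_chiSplittingLine L e dV hdV hdV0 χ hχu hχs (TW (Fp L) a) (isSymm_TW (Fp L) a) (isUnit_det_TW (Fp L) a)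
        (JW (Fp L) L a) (JW_eq (Fp L) L a)))
    (commute_finPairRepV_finPairRepW (Fp L) L (IsCMField.complexConj L) N 1 e' (Matrix.diagonal dV) (JW (Fp L) L a)
      (complexConj_imagUnit L) (imagUnit_ne_zero L) (imagUnit_mul_self L) (realDiagonal_isSymm L dV hdV) (isSymm_TW (Fp L) a)
      (isUnit_det_realDiagonal L dV hdV hdV0) (isUnit_det_TW (Fp L) a) (realDiagonal_map L dV hdV).symm (JW_eq (Fp L) L a)
      (isCompatible_chiSplittingLine L e' dV hdV hdV0 χ hχu hχs (TW (Fp L) a) (isSymm_TW (Fp L) a) (isUnit_det_TW (Fp L) a)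
        (JW (Fp L) L a) (JW_eq (Fp L) L a)))
    (LinearEquiv.refl ℂ (FinSB (Fp L) (Fin N × Fin 1))) 1 hW hχ (g := k) (g' := k) (a := (1 : ℂ)) (hV k) x
  rw [one_smul] at h
  exact h.symm

end Carriers

end Literature.NumberTheory.Automorphic.Liu2021.Def411WeilCarriersDoubling

end
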